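import Literature.Probability.Distributions.TrinomialLineSection
import HarnessLib

/-!
# Linear mode brackets for the line section of the trivariate hypergeometric law

Continuation of `TrinomialLineSection.lean` (that file is at the 200 KB cap; §1–§16 there). The variance floor
`var_lineW_ge_of_bracket` (§15 there) takes MODE BRACKETS `lo + 1 ≤ hi` with `D(lo) < N(lo)` and `N(hi) < D(hi)`,
where `N(α) = (a−α)·j(j−1)·(d−m)` and `D(α) = (α+1)(b+2−j)(b+1−j)(m+1)` (`j = x − 2α`, `m = s + α − x`) are the
numerator and denominator of the consecutive ratio `W(α+1)/W(α)` [Chattamvelli–Shanmugam 2020, §7.4 Table 7.1: the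
hypergeometric recurrence; the mode of a hypergeometric-type law is where the ratio crosses `1`]. These cubic sign
conditions follow from THREE LINEAR inequalities each — «`lo` lies below, `hi` above, the proportional point in all
three coordinates», with the sampling rate `p = s/N` cross-multiplied (`N = a + b + d`):

* `denom_lt_numer_of_linear`: `(lo+1)·N ≤ (a+1)·s`, `(b+1)·s + N ≤ (x−2lo)·N`, `(s+lo+1−x)·N < (d+1)·s` ⇒ `D(lo) < N(lo)`
  (factor by factor `(a−lo)/(lo+1) ≥ (1−p)/p`, `j(j−1)/((b+2−j)(b+1−j)) ≥ (p/(1−p))²`, `(d−m)/(m+1) > (1−p)/p`, and the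
  three proportional rates multiply to `1`);
* `numer_lt_denom_of_linear`: `(a+1)·s < (hi+1)·N`, `(x−2hi)·N ≤ (b+1)·s`, `(d+1)·s ≤ (s+hi+1−x)·N` ⇒ `N(hi) < D(hi)`;
* **`var_lineW_ge_of_linearBracket`**: the variance floor `(r²/2)·Σ_{α≤a} W ≤ Σ_{α≤a} (α − m)²·W` (every real centre
  `m`) under the linear bracket conditions, the margins on `[lo+1, hi]`, `16L(L+1) ≤ M` and `4r+2 ≤ L+1` — no cubic
  left. With `x = s(2a+b)/N + ξ` the conditions hold for `lo ≤ sa/N − |ξ| − 2`, `hi ≥ sa/N + |ξ| + 2`: the bracket is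
  the typical `HH` count ± (window half-width + 2).

* §2 (v2) **`var_lineW_ge_of_window`** — the floor FROM THE WINDOW ALONE: `|x − s(2a+b)/N| ≤ ε` (real form) and
  six product margins `C·N ≤ s·a, a·(N−s), s·b, b·(N−s), s·d, d·(N−s)` with `C = M + 2L + 3ε + 7` give the
  brackets (`lo = ⌊sa/N⌋ − ε − 2`, `hi = ⌊sa/N⌋ + ε + 3`) and the margins; conclusion `(r²/2)·ΣW ≤ Σ(α−m)²W`.

All PROVED, no definitions, no named facts (cell pnp-psdrank, prover MEMO-30 (B3a): the variance floor (V) of brick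
130 with the mode located by linear data; nothing here is about psd rank or P vs NP).

## References
* [ChattamvelliShanmugam2020] R. Chattamvelli, R. Shanmugam, *Discrete Distributions in Engineering and the Applied
  Sciences* (2020), §7.4 (PDF p. 143 Table 7.1: the hypergeometric recurrence; p. 144: the multivariate law).
* [SaumardWellner2014] A. Saumard, J. A. Wellner, *Log-concavity and strong log-concavity: a review*, Statistics
  Surveys 8 (2014), §4 (arXiv p. 13).
* [Durrett2019] R. Durrett, *Probability: Theory and Examples*, 5th ed. (2019), Thm. 1.6.4 (Chebyshev's inequality).
-/

namespace Literature.Probability.Distributions.TrinomialLineSection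

/-! ### §1 The sign of `N − D` from three linear inequalities; the variance floor from linear brackets

`N(α) = (a−α)·j(j−1)·(d−m)` and `D(α) = (α+1)(b+2−j)(b+1−j)(m+1)` (`j = x − 2α`, `m = s + α − x`) compare factor by
factor with the proportional rates `p = s/N`, `1 − p`, `N = a + b + d`: `(a−α)/(α+1) ≥ (1−p)/p` iff `(α+1)N ≤ (a+1)s`,
`(j−1)/(b+2−j) ≥ p/(1−p)` iff `(b+1)s + N ≤ jN`, `(d−m)/(m+1) > (1−p)/p` iff `(m+1)N < (d+1)s`; the product of the
three proportional rates is `((1−p)/p)·(p/(1−p))²·((1−p)/p) = 1`. So «`lo` below the proportional point in all three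
coordinates» gives `D(lo) < N(lo)` and «`hi` above it» gives `N(hi) < D(hi)` — LINEAR conditions replacing the cubic
sign conditions of `lt_max_of_denom_lt_numer` / `max_le_of_numer_lt_denom`; with `x = s(2a+b)/N + ξ` they hold for
`lo ≤ sa/N − |ξ| − 2`, `hi ≥ sa/N + |ξ| + 2` (the typical `HH` count ± the window). -/

/-- **Lower linear bracket**: if `lo ≤ a`, `2·lo + 2 ≤ x ≤ s + lo`, `s + lo ≤ x + d`, `x ≤ 2·lo + b + 1`, `1 ≤ s`,
`s + 1 ≤ N` (`N = a + b + d`) and the three linear inequalities `(lo+1)·N ≤ (a+1)·s`, `(b+1)·s + N ≤ (x − 2lo)·N`,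
`(s + lo + 1 − x)·N < (d+1)·s` hold, then `D(lo) < N(lo)`.
[cite: ChattamvelliShanmugam2020, §7.4 Table 7.1 (PDF p. 143), the mode of a hypergeometric-type law from its ratio] -/
theorem denom_lt_numer_of_linear {a b d s x lo : ℕ} (h1 : lo ≤ a) (h2 : 2 * lo + 2 ≤ x) (h3 : x ≤ s + lo)
    (h4 : s + lo ≤ x + d) (h5 : x ≤ 2 * lo + b + 1) (hs : 1 ≤ s) (hN : s + 1 ≤ a + b + d)
    (i1 : (lo + 1) * (a + b + d) ≤ (a + 1) * s) (i2 : (b + 1) * s + (a + b + d) ≤ (x - 2 * lo) * (a + b + d))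
    (i3 : (s + lo + 1 - x) * (a + b + d) < (d + 1) * s) :
    (lo + 1) * ((b + 2 - (x - 2 * lo)) * (b + 1 - (x - 2 * lo))) * (s + lo + 1 - x) <
      (a - lo) * ((x - 2 * lo) * (x - 2 * lo - 1)) * (d - (s + lo - x)) := by
  -- honest variables
  obtain ⟨A, hA⟩ : ∃ A, a = lo + A := ⟨a - lo, by omega⟩
  obtain ⟨J, hJ⟩ : ∃ J, x = 2 * lo + J + 2 := ⟨x - 2 * lo - 2, by omega⟩
  obtain ⟨Mm, hMm⟩ : ∃ Mm, s + lo = x + Mm := ⟨s + lo - x, by omega⟩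
  obtain ⟨Dm, hDm⟩ : ∃ Dm, d = Mm + Dm := ⟨d - Mm, by omega⟩
  obtain ⟨B, hB⟩ : ∃ B, b + 1 = J + 2 + B := ⟨b + 1 - (J + 2), by omega⟩
  obtain ⟨R, hR⟩ : ∃ R, a + b + d = s + R + 1 := ⟨a + b + d - s - 1, by omega⟩
  have eA : a - lo = A := by omega
  have eJ : x - 2 * lo = J + 2 := by omega
  have eJ1 : x - 2 * lo - 1 = J + 1 := by omega
  have eM1 : s + lo + 1 - x = Mm + 1 := by omega
  have eD : d - (s + lo - x) = Dm := by omega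
  have eB2 : b + 2 - (x - 2 * lo) = B + 1 := by omega
  have eB1 : b + 1 - (x - 2 * lo) = B := by omega
  rw [eA, eB2, eB1, eJ1, eJ, eM1, eD]
  rw [eJ, hR, hB] at i2
  rw [eM1, hR, hDm] at i3
  rw [hR, hA] at i1
  -- the three factor inequalities, cross-multiplied with `N − s = R + 1`
  have f1 : (lo + 1) * (R + 1) ≤ A * s := by
    have e1 : (lo + 1) * (s + R + 1) = (lo + 1) * s + (lo + 1) * (R + 1) := by ring
    have e2 : (lo + A + 1) * s = (lo + 1) * s + A * s := by ring
    rw [e1, e2] at i1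
    exact Nat.le_of_add_le_add_left i1
  have f2 : (B + 1) * s ≤ (J + 1) * (R + 1) := by
    have e1 : (J + 2 + B) * s + (s + R + 1) = (J + 2) * s + ((B + 1) * s + (R + 1)) := by ring
    have e2 : (J + 2) * (s + R + 1) = (J + 2) * s + ((J + 1) * (R + 1) + (R + 1)) := by ring
    rw [e1, e2] at i2
    exact Nat.le_of_add_le_add_right (Nat.le_of_add_le_add_left i2)
  have f2' : B * s ≤ (J + 2) * (R + 1) :=
    calc B * s ≤ (B + 1) * s := Nat.mul_le_mul_right _ (by omega)
      _ ≤ (J + 1) * (R + 1) := f2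
      _ ≤ (J + 2) * (R + 1) := Nat.mul_le_mul_right _ (by omega)
  have f3 : (Mm + 1) * (R + 1) < Dm * s := by
    have e1 : (Mm + 1) * (s + R + 1) = (Mm + 1) * s + (Mm + 1) * (R + 1) := by ring
    have e2 : (Mm + Dm + 1) * s = (Mm + 1) * s + Dm * s := by ring
    rw [e1, e2] at i3
    exact Nat.lt_of_add_lt_add_left i3
  have hA0 : 0 < A := by
    rcases Nat.eq_zero_or_pos A with h0 | h0
    · rw [h0, zero_mul] at f1
      have : 0 < (lo + 1) * (R + 1) := Nat.mul_pos (by omega) (by omega)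
      omega
    · exact h0
  -- multiply: D·(s²(R+1)²) < N·(s²(R+1)²)
  refine Nat.lt_of_mul_lt_mul_right (a := s * s * ((R + 1) * (R + 1))) ?_
  have h12 : ((lo + 1) * (R + 1)) * ((B + 1) * s) * (B * s) ≤ (A * s) * ((J + 1) * (R + 1)) * ((J + 2) * (R + 1)) :=
    Nat.mul_le_mul (Nat.mul_le_mul f1 f2) f2'
  have hX : 0 < (A * s) * ((J + 1) * (R + 1)) * ((J + 2) * (R + 1)) :=
    Nat.mul_pos (Nat.mul_pos (Nat.mul_pos hA0 (by omega)) (by positivity)) (by positivity)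
  calc (lo + 1) * ((B + 1) * B) * (Mm + 1) * (s * s * ((R + 1) * (R + 1)))
      = (((lo + 1) * (R + 1)) * ((B + 1) * s) * (B * s)) * ((Mm + 1) * (R + 1)) := by ring
    _ ≤ ((A * s) * ((J + 1) * (R + 1)) * ((J + 2) * (R + 1))) * ((Mm + 1) * (R + 1)) :=
        Nat.mul_le_mul_right _ h12
    _ < ((A * s) * ((J + 1) * (R + 1)) * ((J + 2) * (R + 1))) * (Dm * s) := Nat.mul_lt_mul_of_pos_left f3 hX
    _ = A * ((J + 2) * (J + 1)) * Dm * (s * s * ((R + 1) * (R + 1))) := by ring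

/-- **Upper linear bracket**: if `hi ≤ a`, `2·hi ≤ x ≤ s + hi`, `s + hi ≤ x + d`, `x ≤ 2·hi + b + 1`, `1 ≤ s`,
`s + 1 ≤ N` and `(a+1)·s < (hi+1)·N`, `(x − 2hi)·N ≤ (b+1)·s`, `(d+1)·s ≤ (s + hi + 1 − x)·N`, then `N(hi) < D(hi)`.
[cite: ChattamvelliShanmugam2020, §7.4 Table 7.1 (PDF p. 143)] -/
theorem numer_lt_denom_of_linear {a b d s x hi : ℕ} (h1 : hi ≤ a) (h2 : 2 * hi ≤ x) (h3 : x ≤ s + hi)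
    (h4 : s + hi ≤ x + d) (h5 : x ≤ 2 * hi + b + 1) (hs : 1 ≤ s) (hN : s + 1 ≤ a + b + d)
    (i1 : (a + 1) * s < (hi + 1) * (a + b + d)) (i2 : (x - 2 * hi) * (a + b + d) ≤ (b + 1) * s)
    (i3 : (d + 1) * s ≤ (s + hi + 1 - x) * (a + b + d)) :
    (a - hi) * ((x - 2 * hi) * (x - 2 * hi - 1)) * (d - (s + hi - x)) <
      (hi + 1) * ((b + 2 - (x - 2 * hi)) * (b + 1 - (x - 2 * hi))) * (s + hi + 1 - x) := by
  obtain ⟨A, hA⟩ : ∃ A, a = hi + A := ⟨a - hi, by omega⟩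
  obtain ⟨J, hJ⟩ : ∃ J, x = 2 * hi + J := ⟨x - 2 * hi, by omega⟩
  obtain ⟨Mm, hMm⟩ : ∃ Mm, s + hi = x + Mm := ⟨s + hi - x, by omega⟩
  obtain ⟨Dm, hDm⟩ : ∃ Dm, d = Mm + Dm := ⟨d - Mm, by omega⟩
  obtain ⟨B, hB⟩ : ∃ B, b + 1 = J + B := ⟨b + 1 - J, by omega⟩
  obtain ⟨R, hR⟩ : ∃ R, a + b + d = s + R + 1 := ⟨a + b + d - s - 1, by omega⟩
  have eA : a - hi = A := by omega
  have eJ : x - 2 * hi = J := by omega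
  have eM1 : s + hi + 1 - x = Mm + 1 := by omega
  have eD : d - (s + hi - x) = Dm := by omega
  have eB2 : b + 2 - (x - 2 * hi) = B + 1 := by omega
  have eB1 : b + 1 - (x - 2 * hi) = B := by omega
  rw [eA, eB2, eB1, eJ, eM1, eD]
  rw [eJ, hR, hB] at i2
  rw [eM1, hR, hDm] at i3
  rw [hR, hA] at i1
  have f1 : A * s < (hi + 1) * (R + 1) := by
    have e1 : (hi + A + 1) * s = (hi + 1) * s + A * s := by ring
    have e2 : (hi + 1) * (s + R + 1) = (hi + 1) * s + (hi + 1) * (R + 1) := by ring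
    rw [e1, e2] at i1
    exact Nat.lt_of_add_lt_add_left i1
  have f2 : J * (R + 1) ≤ B * s := by
    have e1 : J * (s + R + 1) = J * s + J * (R + 1) := by ring
    have e2 : (J + B) * s = J * s + B * s := by ring
    rw [e1, e2] at i2
    exact Nat.le_of_add_le_add_left i2
  have f2' : (J - 1) * (R + 1) ≤ (B + 1) * s :=
    calc (J - 1) * (R + 1) ≤ J * (R + 1) := Nat.mul_le_mul_right _ (Nat.sub_le J 1)
      _ ≤ B * s := f2
      _ ≤ (B + 1) * s := Nat.mul_le_mul_right _ (by omega)
  have f3 : Dm * s ≤ (Mm + 1) * (R + 1) := by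
    have e1 : (Mm + Dm + 1) * s = (Mm + 1) * s + Dm * s := by ring
    have e2 : (Mm + 1) * (s + R + 1) = (Mm + 1) * s + (Mm + 1) * (R + 1) := by ring
    rw [e1, e2] at i3
    exact Nat.le_of_add_le_add_left i3
  have hB0 : 0 < B := by
    rcases Nat.eq_zero_or_pos B with h0 | h0
    · -- `B = 0` forces `J = 0` (from `f2`) and then `b + 1 = 0`: impossible
      rw [h0, zero_mul] at f2
      have hJ0 : J * (R + 1) = 0 := Nat.le_zero.1 f2
      rcases Nat.mul_eq_zero.1 hJ0 with h | h <;> omega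
    · exact h0
  refine Nat.lt_of_mul_lt_mul_right (a := s * s * ((R + 1) * (R + 1))) ?_
  have h23 : (J * (R + 1)) * ((J - 1) * (R + 1)) * (Dm * s) ≤ (B * s) * ((B + 1) * s) * ((Mm + 1) * (R + 1)) :=
    Nat.mul_le_mul (Nat.mul_le_mul f2 f2') f3
  have hY : 0 < (B * s) * ((B + 1) * s) * ((Mm + 1) * (R + 1)) :=
    Nat.mul_pos (Nat.mul_pos (Nat.mul_pos hB0 (by omega)) (Nat.mul_pos (by omega) (by omega))) (by positivity)
  calc A * (J * (J - 1)) * Dm * (s * s * ((R + 1) * (R + 1)))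
      = (A * s) * ((J * (R + 1)) * ((J - 1) * (R + 1)) * (Dm * s)) := by ring
    _ ≤ (A * s) * ((B * s) * ((B + 1) * s) * ((Mm + 1) * (R + 1))) := Nat.mul_le_mul_left _ h23
    _ < ((hi + 1) * (R + 1)) * ((B * s) * ((B + 1) * s) * ((Mm + 1) * (R + 1))) :=
        Nat.mul_lt_mul_of_pos_right f1 hY
    _ = (hi + 1) * ((B + 1) * B) * (Mm + 1) * (s * s * ((R + 1) * (R + 1))) := by ring

/-- **THE VARIANCE FLOOR from LINEAR brackets (B3a, mode-location free).** As `var_lineW_ge_of_bracket`, with the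
cubic bracket conditions replaced by the linear ones of `denom_lt_numer_of_linear` (at `lo`) and
`numer_lt_denom_of_linear` (at `hi`): `(lo+1)N ≤ (a+1)s`, `(b+1)s + N ≤ (x−2lo)N`, `(s+lo+1−x)N < (d+1)s`,
`(a+1)s < (hi+1)N`, `(x−2hi)N ≤ (b+1)s`, `(d+1)s ≤ (s+hi+1−x)N` (`N = a+b+d`, `1 ≤ s ≤ N − 1`), plus the margins on
`[lo+1, hi]` and `16L(L+1) ≤ M`, `4r+2 ≤ L+1`. Then `(r²/2)·Σ_{α≤a} W ≤ Σ_{α≤a} (α−m)²·W` for every real `m`.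
[cite: SaumardWellner2014, §4 (arXiv p. 13)] [cite: Durrett2019, Thm. 1.6.4 (Chebyshev's inequality)]
[cite: ChattamvelliShanmugam2020, §7.4 Table 7.1 (PDF p. 143)] -/
theorem var_lineW_ge_of_linearBracket (a b d s x lo hi M L : ℕ) (hM : 2 ≤ M) (hL1 : 1 ≤ L) (hlohi : lo + 1 ≤ hi)
    (hs : 1 ≤ s) (hN : s + 1 ≤ a + b + d)
    (i1 : (lo + 1) * (a + b + d) ≤ (a + 1) * s) (i2 : (b + 1) * s + (a + b + d) ≤ (x - 2 * lo) * (a + b + d))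
    (i3 : (s + lo + 1 - x) * (a + b + d) < (d + 1) * s)
    (j1 : (a + 1) * s < (hi + 1) * (a + b + d)) (j2 : (x - 2 * hi) * (a + b + d) ≤ (b + 1) * s)
    (j3 : (d + 1) * s ≤ (s + hi + 1 - x) * (a + b + d))
    (m1 : hi + L + M ≤ a) (m2 : M + L ≤ lo + 3) (m2' : L ≤ lo) (m3 : 2 * (hi + L) + M + 1 ≤ x)
    (m4 : x + M + 2 * L ≤ 2 * (lo + 1) + b + 3) (m5 : x + M + L ≤ s + lo + 3) (m6 : s + hi + L + M ≤ x + d)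
    (hLM : 16 * (L * (L + 1)) ≤ M) (r : ℕ) (hr : 4 * r + 2 ≤ L + 1) (m : ℝ) :
    ((r : ℝ) ^ 2 / 2) * ∑ α ∈ Finset.range (a + 1), (lineW a b d s x α : ℝ) ≤
      ∑ α ∈ Finset.range (a + 1), ((α : ℝ) - m) ^ 2 * lineW a b d s x α := by
  have hLL : 1 * (1 + 1) ≤ L * (L + 1) := Nat.mul_le_mul hL1 (by omega)
  have hlo := denom_lt_numer_of_linear (a := a) (b := b) (d := d) (s := s) (x := x) (lo := lo)
    (by omega) (by omega) (by omega) (by omega) (by omega) hs hN i1 i2 i3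
  have hhi := numer_lt_denom_of_linear (a := a) (b := b) (d := d) (s := s) (x := x) (hi := hi)
    (by omega) (by omega) (by omega) (by omega) (by omega) hs hN j1 j2 j3
  exact var_lineW_ge_of_bracket a b d s x lo hi M L hM hL1 hlohi hlo hhi m1 m2 m2' m3 m4 m5 m6 hLM r hr m


/-! ### §2 (v2) The brackets and the margins FROM THE WINDOW ALONE

With `q = ⌊sa/N⌋` (`N = a+b+d`), `lo = q − ε − 2` and `hi = q + ε + 3`: the window `|x − s(2a+b)/N| ≤ ε` ALONE
gives the six linear bracket conditions of §1 (e.g. `(x−2lo)N ≥ sb + (ε+4)N ≥ (b+1)s + N`, `(s+lo+1−x)N ≤ sd − N`),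
and six PRODUCT margins `C·N ≤ s·a, a·(N−s), s·b, b·(N−s), s·d, d·(N−s)` with the one constant
`C = M + 2L + 3ε + 7` give the margins `m1`–`m6` of `var_lineW_ge_of_bracket` on `[lo+1, hi]` (each by one
linear combination, LIT-53 §3). In the cell `s ≈ N/2`, `a, b, d ≥ βN`, so `C ≤ βN/2` is the requirement:
the variance floor (V) from the block-statistic window and the type margins only (prover MEMO-30 rev 2, the
last input of the assembly brick '136'). -/

/-- The real window `|x − s(2a+b)/N| ≤ ε`, cross-multiplied in `ℕ`. [folklore] -/
private theorem win_nat {a b d s x ε : ℕ} (hNpos : 0 < a + b + d)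
    (hx : |(x : ℝ) - (s : ℝ) * (2 * a + b) / ((a : ℝ) + b + d)| ≤ ε) :
    s * (2 * a + b) ≤ x * (a + b + d) + ε * (a + b + d) ∧ x * (a + b + d) ≤ s * (2 * a + b) + ε * (a + b + d) := by
  have hNr : (0 : ℝ) < (a : ℝ) + b + d := by exact_mod_cast (show (0 : ℕ) < a + b + d from hNpos)
  obtain ⟨hx_lo, hx_hi⟩ := abs_le.1 hx
  have e1 : (s : ℝ) * (2 * a + b) ≤ ((x : ℝ) + ε) * ((a : ℝ) + b + d) := by
    rw [← div_le_iff₀ hNr]; linarith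
  have e2 : ((x : ℝ) - ε) * ((a : ℝ) + b + d) ≤ (s : ℝ) * (2 * a + b) := by
    rw [← le_div_iff₀ hNr]; linarith
  constructor
  · have : (s : ℝ) * (2 * a + b) ≤ (x : ℝ) * ((a : ℝ) + b + d) + (ε : ℝ) * ((a : ℝ) + b + d) := by linarith [e1]
    exact_mod_cast this
  · have : (x : ℝ) * ((a : ℝ) + b + d) ≤ (s : ℝ) * (2 * a + b) + (ε : ℝ) * ((a : ℝ) + b + d) := by linarith [e2]
    exact_mod_cast this

/-- Margin `m1` from the window data. [folklore] -/
private theorem win_m1 {a b d s ε M L lo : ℕ} (hNpos : 0 < a + b + d) (hsN : s ≤ a + b + d)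
    (hq1 : (lo + ε + 2) * (a + b + d) ≤ s * a) (wa' : (M + 2 * L + 3 * ε + 7) * (a + b + d) ≤ a * (a + b + d - s)) :
    lo + 2 * ε + 5 + L + M ≤ a := by
  refine Nat.le_of_mul_le_mul_right ?_ hNpos
  have hq1z : ((lo : ℤ) + ε + 2) * (a + b + d) ≤ s * a := by exact_mod_cast hq1
  have wa'z : ((M : ℤ) + 2 * L + 3 * ε + 7) * (a + b + d) ≤ a * ((a + b + d : ℤ) - s) := by
    have := wa'; zify [hsN] at this; linarith
  have pε : (0 : ℤ) ≤ (ε : ℤ) * (a + b + d) := by positivity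
  have pL : (0 : ℤ) ≤ (L : ℤ) * (a + b + d) := by positivity
  have pN : (0 : ℤ) ≤ (a : ℤ) + b + d := by positivity
  have : ((lo : ℤ) + 2 * ε + 5 + L + M) * (a + b + d) ≤ a * (a + b + d) := by linarith
  exact_mod_cast this

/-- Margins `m2`, `m2'` from the window data. [folklore] -/
private theorem win_m2 {a b d s ε M L lo : ℕ}
    (hq2 : s * a < (lo + ε + 2) * (a + b + d) + (a + b + d)) (wa : (M + 2 * L + 3 * ε + 7) * (a + b + d) ≤ s * a) :
    M + L + ε + 4 ≤ lo := by
  have h : (M + 2 * L + 3 * ε + 7) * (a + b + d) < (lo + ε + 3) * (a + b + d) := by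
    rw [show (lo + ε + 3) * (a + b + d) = (lo + ε + 2) * (a + b + d) + (a + b + d) by ring]; exact lt_of_le_of_lt wa hq2
  have := Nat.lt_of_mul_lt_mul_right h
  omega

/-- Margin `m3` from the window data. [folklore] -/
private theorem win_m3 {a b d s x ε M L lo : ℕ} (hNpos : 0 < a + b + d)
    (hq1 : (lo + ε + 2) * (a + b + d) ≤ s * a) (wb : (M + 2 * L + 3 * ε + 7) * (a + b + d) ≤ s * b)
    (hx1 : s * (2 * a + b) ≤ x * (a + b + d) + ε * (a + b + d)) :
    2 * (lo + 2 * ε + 5 + L) + M + 1 ≤ x := by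
  refine Nat.le_of_mul_le_mul_right ?_ hNpos
  have hq1z : ((lo : ℤ) + ε + 2) * (a + b + d) ≤ s * a := by exact_mod_cast hq1
  have wbz : ((M : ℤ) + 2 * L + 3 * ε + 7) * (a + b + d) ≤ s * b := by exact_mod_cast wb
  have hx1z : (s : ℤ) * (2 * a + b) ≤ x * (a + b + d) + ε * (a + b + d) := by exact_mod_cast hx1
  have : ((2 : ℤ) * (lo + 2 * ε + 5 + L) + M + 1) * (a + b + d) ≤ x * (a + b + d) := by linarith
  exact_mod_cast this

/-- Margin `m4` from the window data. [folklore] -/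
private theorem win_m4 {a b d s x ε M L lo : ℕ} (hNpos : 0 < a + b + d) (hsN : s ≤ a + b + d)
    (hq2 : s * a < (lo + ε + 2) * (a + b + d) + (a + b + d))
    (wb' : (M + 2 * L + 3 * ε + 7) * (a + b + d) ≤ b * (a + b + d - s))
    (hx2 : x * (a + b + d) ≤ s * (2 * a + b) + ε * (a + b + d)) :
    x + M + 2 * L ≤ 2 * (lo + 1) + b + 3 := by
  refine Nat.le_of_mul_le_mul_right ?_ hNpos
  have hq2z : (s : ℤ) * a < ((lo : ℤ) + ε + 2) * (a + b + d) + (a + b + d) := by exact_mod_cast hq2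
  have wb'z : ((M : ℤ) + 2 * L + 3 * ε + 7) * (a + b + d) ≤ b * ((a + b + d : ℤ) - s) := by
    have := wb'; zify [hsN] at this; linarith
  have hx2z : (x : ℤ) * (a + b + d) ≤ s * (2 * a + b) + ε * (a + b + d) := by exact_mod_cast hx2
  have pN : (0 : ℤ) ≤ (a : ℤ) + b + d := by positivity
  have : ((x : ℤ) + M + 2 * L) * (a + b + d) ≤ (2 * (lo + 1) + b + 3) * (a + b + d) := by linarith
  exact_mod_cast this

/-- Margin `m5` from the window data. [folklore] -/
private theorem win_m5 {a b d s x ε M L lo : ℕ} (hNpos : 0 < a + b + d)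
    (hq2 : s * a < (lo + ε + 2) * (a + b + d) + (a + b + d))
    (wd : (M + 2 * L + 3 * ε + 7) * (a + b + d) ≤ s * d)
    (hx2 : x * (a + b + d) ≤ s * (2 * a + b) + ε * (a + b + d)) :
    x + M + L ≤ s + lo + 3 := by
  refine Nat.le_of_mul_le_mul_right ?_ hNpos
  have hq2z : (s : ℤ) * a < ((lo : ℤ) + ε + 2) * (a + b + d) + (a + b + d) := by exact_mod_cast hq2
  have wdz : ((M : ℤ) + 2 * L + 3 * ε + 7) * (a + b + d) ≤ s * d := by exact_mod_cast wd
  have hx2z : (x : ℤ) * (a + b + d) ≤ s * (2 * a + b) + ε * (a + b + d) := by exact_mod_cast hx2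
  have pε : (0 : ℤ) ≤ (ε : ℤ) * (a + b + d) := by positivity
  have pL : (0 : ℤ) ≤ (L : ℤ) * (a + b + d) := by positivity
  have pN : (0 : ℤ) ≤ (a : ℤ) + b + d := by positivity
  have : ((x : ℤ) + M + L) * (a + b + d) ≤ (s + lo + 3) * (a + b + d) := by linarith
  exact_mod_cast this

/-- Margin `m6` from the window data. [folklore] -/
private theorem win_m6 {a b d s x ε M L lo : ℕ} (hNpos : 0 < a + b + d) (hsN : s ≤ a + b + d)
    (hq1 : (lo + ε + 2) * (a + b + d) ≤ s * a) (wd' : (M + 2 * L + 3 * ε + 7) * (a + b + d) ≤ d * (a + b + d - s))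
    (hx1 : s * (2 * a + b) ≤ x * (a + b + d) + ε * (a + b + d)) :
    s + (lo + 2 * ε + 5) + L + M ≤ x + d := by
  refine Nat.le_of_mul_le_mul_right ?_ hNpos
  have hq1z : ((lo : ℤ) + ε + 2) * (a + b + d) ≤ s * a := by exact_mod_cast hq1
  have wd'z : ((M : ℤ) + 2 * L + 3 * ε + 7) * (a + b + d) ≤ d * ((a + b + d : ℤ) - s) := by
    have := wd'; zify [hsN] at this; linarith
  have hx1z : (s : ℤ) * (2 * a + b) ≤ x * (a + b + d) + ε * (a + b + d) := by exact_mod_cast hx1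
  have pε : (0 : ℤ) ≤ (ε : ℤ) * (a + b + d) := by positivity
  have pL : (0 : ℤ) ≤ (L : ℤ) * (a + b + d) := by positivity
  have : ((s : ℤ) + (lo + 2 * ε + 5) + L + M) * (a + b + d) ≤ (x + d) * (a + b + d) := by linarith
  exact_mod_cast this

/-- Bracket conditions `i1`, `i2`, `i3` at `lo` from the window data. [folklore] -/
private theorem win_i {a b d s x ε lo : ℕ} (hs : 1 ≤ s) (hN : s + 1 ≤ a + b + d)
    (hq1 : (lo + ε + 2) * (a + b + d) ≤ s * a)
    (hx1 : s * (2 * a + b) ≤ x * (a + b + d) + ε * (a + b + d)) (hxlo : 2 * lo ≤ x) (hxs : x ≤ s + lo + 1) :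
    (lo + 1) * (a + b + d) ≤ (a + 1) * s ∧ (b + 1) * s + (a + b + d) ≤ (x - 2 * lo) * (a + b + d) ∧
      (s + lo + 1 - x) * (a + b + d) < (d + 1) * s := by
  have hq1z : ((lo : ℤ) + ε + 2) * (a + b + d) ≤ s * a := by exact_mod_cast hq1
  have hx1z : (s : ℤ) * (2 * a + b) ≤ x * (a + b + d) + ε * (a + b + d) := by exact_mod_cast hx1
  have hsz : (1 : ℤ) ≤ s := by exact_mod_cast hs
  have hNz : (s : ℤ) + 1 ≤ a + b + d := by exact_mod_cast hN
  have pε : (0 : ℤ) ≤ (ε : ℤ) * (a + b + d) := by positivity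
  have pN : (0 : ℤ) ≤ (a : ℤ) + b + d := by positivity
  refine ⟨?_, ?_, ?_⟩
  · have : ((lo : ℤ) + 1) * (a + b + d) ≤ (a + 1) * s := by linarith
    exact_mod_cast this
  · have : (((b + 1) * s + (a + b + d) : ℕ) : ℤ) ≤ (((x - 2 * lo) * (a + b + d) : ℕ) : ℤ) := by
      push_cast [Nat.cast_sub hxlo]; linarith
    exact_mod_cast this
  · have : (((s + lo + 1 - x) * (a + b + d) : ℕ) : ℤ) < (((d + 1) * s : ℕ) : ℤ) := by
      push_cast [Nat.cast_sub hxs]; linarith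
    exact_mod_cast this

/-- Bracket conditions `j1`, `j2`, `j3` at `hi = lo + 2ε + 5` from the window data. [folklore] -/
private theorem win_j {a b d s x ε lo : ℕ} (hs : 1 ≤ s) (hN : s + 1 ≤ a + b + d)
    (hq2 : s * a < (lo + ε + 2) * (a + b + d) + (a + b + d))
    (hx2 : x * (a + b + d) ≤ s * (2 * a + b) + ε * (a + b + d)) (hxs : x ≤ s + (lo + 2 * ε + 5) + 1) :
    (a + 1) * s < (lo + 2 * ε + 5 + 1) * (a + b + d) ∧ (x - 2 * (lo + 2 * ε + 5)) * (a + b + d) ≤ (b + 1) * s ∧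
      (d + 1) * s ≤ (s + (lo + 2 * ε + 5) + 1 - x) * (a + b + d) := by
  have hq2z : (s : ℤ) * a < ((lo : ℤ) + ε + 2) * (a + b + d) + (a + b + d) := by exact_mod_cast hq2
  have hx2z : (x : ℤ) * (a + b + d) ≤ s * (2 * a + b) + ε * (a + b + d) := by exact_mod_cast hx2
  have hsz : (1 : ℤ) ≤ s := by exact_mod_cast hs
  have hNz : (s : ℤ) + 1 ≤ a + b + d := by exact_mod_cast hN
  have pε : (0 : ℤ) ≤ (ε : ℤ) * (a + b + d) := by positivity
  have pN : (0 : ℤ) ≤ (a : ℤ) + b + d := by positivity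
  refine ⟨?_, ?_, ?_⟩
  · have : ((a : ℤ) + 1) * s < ((lo : ℤ) + 2 * ε + 5 + 1) * (a + b + d) := by linarith
    exact_mod_cast this
  · rcases Nat.lt_or_ge x (2 * (lo + 2 * ε + 5)) with h | h
    · rw [Nat.sub_eq_zero_of_le h.le, zero_mul]; exact Nat.zero_le _
    · have : (((x - 2 * (lo + 2 * ε + 5)) * (a + b + d) : ℕ) : ℤ) ≤ (((b + 1) * s : ℕ) : ℤ) := by
        push_cast [Nat.cast_sub h]; linarith
      exact_mod_cast this
  · have : (((d + 1) * s : ℕ) : ℤ) ≤ (((s + (lo + 2 * ε + 5) + 1 - x) * (a + b + d) : ℕ) : ℤ) := by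
      push_cast [Nat.cast_sub hxs]; linarith
    exact_mod_cast this

/-- **THE VARIANCE FLOOR FROM THE WINDOW (B3a, final form).** For a line section `W = lineW a b d s x` with
`1 ≤ s`, `s + 1 ≤ N = a + b + d`, block value `x` in the window `|x − s(2a+b)/N| ≤ ε` (real form), product
margins `C·N ≤ s·a`, `C·N ≤ a·(N−s)`, `C·N ≤ s·b`, `C·N ≤ b·(N−s)`, `C·N ≤ s·d`, `C·N ≤ d·(N−s)` with
`C = M + 2L + 3ε + 7`, and `2 ≤ M`, `1 ≤ L`, `16L(L+1) ≤ M`, `4r + 2 ≤ L + 1`: for every real centre `m`,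
`(r²/2)·Σ_{α≤a} W(α) ≤ Σ_{α≤a} (α − m)²·W(α)`. (Brackets `lo = ⌊sa/N⌋ − ε − 2`, `hi = ⌊sa/N⌋ + ε + 3`.)
[cite: SaumardWellner2014, §4 (arXiv p. 13)] [cite: Durrett2019, Thm. 1.6.4 (Chebyshev's inequality)]
[cite: ChattamvelliShanmugam2020, §7.4 Table 7.1 (PDF p. 143)] -/
theorem var_lineW_ge_of_window (a b d s x ε M L r : ℕ) (m : ℝ) (hs : 1 ≤ s) (hN : s + 1 ≤ a + b + d)
    (hx : |(x : ℝ) - (s : ℝ) * (2 * a + b) / ((a : ℝ) + b + d)| ≤ ε)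
    (wa : (M + 2 * L + 3 * ε + 7) * (a + b + d) ≤ s * a) (wa' : (M + 2 * L + 3 * ε + 7) * (a + b + d) ≤ a * (a + b + d - s))
    (wb : (M + 2 * L + 3 * ε + 7) * (a + b + d) ≤ s * b) (wb' : (M + 2 * L + 3 * ε + 7) * (a + b + d) ≤ b * (a + b + d - s))
    (wd : (M + 2 * L + 3 * ε + 7) * (a + b + d) ≤ s * d) (wd' : (M + 2 * L + 3 * ε + 7) * (a + b + d) ≤ d * (a + b + d - s))
    (hM : 2 ≤ M) (hL1 : 1 ≤ L) (hLM : 16 * (L * (L + 1)) ≤ M) (hr : 4 * r + 2 ≤ L + 1) :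
    ((r : ℝ) ^ 2 / 2) * ∑ α ∈ Finset.range (a + 1), (lineW a b d s x α : ℝ) ≤
      ∑ α ∈ Finset.range (a + 1), ((α : ℝ) - m) ^ 2 * lineW a b d s x α := by
  have hNpos : 0 < a + b + d := by omega
  have hsN : s ≤ a + b + d := by omega
  obtain ⟨hx1, hx2⟩ := win_nat hNpos hx
  -- `q = ⌊sa/N⌋ ≥ L + ε + 2`; `lo = q − ε − 2`, `hi = q + ε + 3 = lo + 2ε + 5`
  have hqL : L + ε + 2 ≤ s * a / (a + b + d) := by
    rw [Nat.le_div_iff_mul_le hNpos]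
    exact le_trans (Nat.mul_le_mul_right _ (by omega)) wa
  obtain ⟨lo, hlo⟩ : ∃ lo, s * a / (a + b + d) = lo + ε + 2 := ⟨s * a / (a + b + d) - ε - 2, by omega⟩
  have hq1 : (lo + ε + 2) * (a + b + d) ≤ s * a := hlo ▸ Nat.div_mul_le_self _ _
  have hq2 : s * a < (lo + ε + 2) * (a + b + d) + (a + b + d) := hlo ▸ Nat.lt_div_mul_add hNpos
  have m1 := win_m1 hNpos hsN hq1 wa'
  have m2 := win_m2 hq2 wa
  have m3 := win_m3 hNpos hq1 wb hx1
  have m4 := win_m4 hNpos hsN hq2 wb' hx2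
  have m5 := win_m5 hNpos hq2 wd hx2
  have m6 := win_m6 hNpos hsN hq1 wd' hx1
  obtain ⟨i1, i2, i3⟩ := win_i hs hN hq1 hx1 (by omega) (by omega)
  obtain ⟨j1, j2, j3⟩ := win_j (lo := lo) hs hN hq2 hx2 (by omega)
  exact var_lineW_ge_of_linearBracket a b d s x lo (lo + 2 * ε + 5) M L hM hL1 (by omega) hs hN i1 i2 i3 j1 j2 j3
    m1 (by omega) (by omega) m3 m4 m5 m6 hLM r hr m

end Literature.Probability.Distributions.TrinomialLineSection
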